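import Summits.ValiantsHypothesis.ValiantsHypothesis.Theorems.BinomialElusivePeelingLemmaWindowCalculus
import Summits.ValiantsHypothesis.ValiantsHypothesis.Theorems.BinomialElusivePeelingLemmaGadgetBlock

/-!
# The block theta gadget, IV: how the shared letters of `b` and `b'` read the charges; few old letters

Helper for the crux stmt-ValiantsHypothesis-7391 (negative lane; `Cruxes/PeelingLemma/DETERMINISTIC-ALLX.md`
§3f, bookkeeping for the branch case (β) of the gadget local lemma [E]).  In the per-gadget charge
combination `Σ_j Σ_{t ∈ S} c_j(t) · win (birth3 j) q t`, the letter `beta a` of the branch vertex `b`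
is alive on arm `j` during `[τ_j, τ_j + 2q]` with `τ_j = 2q - blockAge j a` (its age at `b` is
`blockAge j a`), so its coefficient is the sum over the arms of the alternating interval sums of the
charges over these lives (`gadget_sum_apply_beta`); dually for `beta' a` with
`τ'_j = 2q + no + 2 + blockAge j a` (`gadget_sum_apply_beta'`).  And the design bound behind the
"young letters" step of (β): at most `5(R+1)` letters of `b` are old (age `≥ 2q - R`) on some arm
(`card_old_letters_le`), so at least `2q + 1 - 5(R+1)` are young on every arm.  No Theses import.
-/

namespace Summit.ValiantsHypothesis.ValiantsHypothesis.Theorems.PeelingLemmaGadget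

-- summit = sub-problem name (single-conjunct summit, D-0017 layout), so the namespace repeats it
set_option linter.dupNamespace false

open scoped BigOperators
open Finset
open Summit.ValiantsHypothesis.ValiantsHypothesis.Theorems.PeelingLemmaWindow

variable {q R no : ℕ}

/-- `beta a` is born on arm `j` at `2q - blockAge j a`. -/
theorem birth3_beta_pos (j : Fin 5) (a : Fin (2 * q + 1)) :
    birth3 q R no j (2 * q - (((blockAge q R j a : Fin (2 * q + 1)) : ℕ) : ℤ)) = GLetter.beta a :=
  (birth3_eq_beta_iff j _ a).mpr rfl

/-- `beta' a` is born on arm `j` at `2q + no + 2 + blockAge j a`. -/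
theorem birth3_beta'_pos (j : Fin 5) (a : Fin (2 * q + 1)) :
    birth3 q R no j (2 * q + no + 2 + (((blockAge q R j a : Fin (2 * q + 1)) : ℕ) : ℤ)) =
      GLetter.beta' a :=
  (birth3_eq_beta'_iff j _ a).mpr rfl

/-- **Reading of a `b`-letter.**  The coefficient of `beta a` in the gadget charge combination is the
sum over the arms `j` of the alternating interval sums of `c_j` over the life
`[τ_j, τ_j + 2q]`, `τ_j = 2q - blockAge j a`, of that letter on arm `j`. -/
theorem gadget_sum_apply_beta (c : Fin 5 → ℤ → ℤ) (S : Finset ℤ) (a : Fin (2 * q + 1)) :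
    (∑ j, ∑ t ∈ S, c j t * win (birth3 q R no j) q t (GLetter.beta a)) =
      ∑ j, ∑ t ∈ S.filter (fun t =>
          (2 * q - (((blockAge q R j a : Fin (2 * q + 1)) : ℕ) : ℤ)) ≤ t ∧
            t ≤ (2 * q - (((blockAge q R j a : Fin (2 * q + 1)) : ℕ) : ℤ)) + 2 * q),
        (-1) ^ (t - (2 * q - (((blockAge q R j a : Fin (2 * q + 1)) : ℕ) : ℤ))).toNat * c j t := by
  refine Finset.sum_congr rfl fun j _ => ?_
  rw [← birth3_beta_pos (q := q) (R := R) (no := no) j a,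
    charge_sum_apply_born (birth3_injective j)]

/-- **Reading of a `b'`-letter.**  The coefficient of `beta' a` is the sum over the arms of the
alternating interval sums of `c_j` over `[τ'_j, τ'_j + 2q]`, `τ'_j = 2q + no + 2 + blockAge j a`. -/
theorem gadget_sum_apply_beta' (c : Fin 5 → ℤ → ℤ) (S : Finset ℤ) (a : Fin (2 * q + 1)) :
    (∑ j, ∑ t ∈ S, c j t * win (birth3 q R no j) q t (GLetter.beta' a)) =
      ∑ j, ∑ t ∈ S.filter (fun t =>
          (2 * q + no + 2 + (((blockAge q R j a : Fin (2 * q + 1)) : ℕ) : ℤ)) ≤ t ∧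
            t ≤ (2 * q + no + 2 + (((blockAge q R j a : Fin (2 * q + 1)) : ℕ) : ℤ)) + 2 * q),
        (-1) ^ (t - (2 * q + no + 2 + (((blockAge q R j a : Fin (2 * q + 1)) : ℕ) : ℤ))).toNat
          * c j t := by
  refine Finset.sum_congr rfl fun j _ => ?_
  rw [← birth3_beta'_pos (q := q) (R := R) (no := no) j a,
    charge_sum_apply_born (birth3_injective j)]

/-! ## Few letters are old on some arm -/

/-- The letters of `b` that are OLD (age `≥ 2q - R`) on arm `j` are the images under the involution
`blockAge j` of the `R+1` top ages; there are at most `R+1` of them. -/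
theorem card_old_on_arm_le (j : Fin 5) :
    (Finset.univ.filter (fun c : Fin (2 * q + 1) =>
        2 * q - R ≤ ((blockAge q R j c : Fin (2 * q + 1)) : ℕ))).card ≤ R + 1 := by
  classical
  -- the filter is the image of the top ages under `blockAge j`
  have hsub : Finset.univ.filter (fun c : Fin (2 * q + 1) =>
        2 * q - R ≤ ((blockAge q R j c : Fin (2 * q + 1)) : ℕ)) ⊆
      (Finset.univ.filter (fun a : Fin (2 * q + 1) => 2 * q - R ≤ (a : ℕ))).image (blockAge q R j) := by
    intro c hc
    rw [Finset.mem_filter] at hc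
    refine Finset.mem_image.mpr ⟨blockAge q R j c, Finset.mem_filter.mpr ⟨Finset.mem_univ _, hc.2⟩, ?_⟩
    rw [blockAge_blockAge]
  refine le_trans (Finset.card_le_card hsub) (le_trans Finset.card_image_le ?_)
  -- the top ages inject into `Fin (R+1)` via `a ↦ 2q - a`
  have : (Finset.univ.filter (fun a : Fin (2 * q + 1) => 2 * q - R ≤ (a : ℕ))).card ≤
      (Finset.range (R + 1)).card := by
    refine Finset.card_le_card_of_injOn (fun a => 2 * q - (a : ℕ)) ?_ ?_
    · intro a ha
      have := (Finset.mem_filter.mp (Finset.mem_coe.mp ha)).2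
      rw [Finset.coe_range, Set.mem_Iio]
      show 2 * q - (a : ℕ) < R + 1
      omega
    · intro a ha a' ha' h
      have h1 := (Finset.mem_filter.mp (Finset.mem_coe.mp ha)).2
      have h2 := (Finset.mem_filter.mp (Finset.mem_coe.mp ha')).2
      have hlt := a.isLt; have hlt' := a'.isLt
      exact Fin.ext (by simp only at h; omega)
  simpa using this

/-- **Few old letters.**  At most `5(R+1)` letters of `b` are old on some arm; hence at least
`2q + 1 - 5(R+1)` letters are young (age `< 2q - R`) on every arm. -/
theorem card_old_letters_le :
    (Finset.univ.filter (fun c : Fin (2 * q + 1) =>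
        ∃ j : Fin 5, 2 * q - R ≤ ((blockAge q R j c : Fin (2 * q + 1)) : ℕ))).card ≤ 5 * (R + 1) := by
  classical
  have heq : Finset.univ.filter (fun c : Fin (2 * q + 1) =>
        ∃ j : Fin 5, 2 * q - R ≤ ((blockAge q R j c : Fin (2 * q + 1)) : ℕ)) =
      Finset.univ.biUnion (fun j : Fin 5 => Finset.univ.filter (fun c : Fin (2 * q + 1) =>
        2 * q - R ≤ ((blockAge q R j c : Fin (2 * q + 1)) : ℕ))) := by
    ext c; simp
  rw [heq]
  refine le_trans Finset.card_biUnion_le ?_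
  calc ∑ j : Fin 5, (Finset.univ.filter (fun c : Fin (2 * q + 1) =>
          2 * q - R ≤ ((blockAge q R j c : Fin (2 * q + 1)) : ℕ))).card
      ≤ ∑ _j : Fin 5, (R + 1) := Finset.sum_le_sum fun j _ => card_old_on_arm_le j
    _ = 5 * (R + 1) := by simp

/-- The complementary count: at least `2q + 1 - 5(R+1)` letters of `b` are young on every arm. -/
theorem le_card_young_letters :
    2 * q + 1 - 5 * (R + 1) ≤ (Finset.univ.filter (fun c : Fin (2 * q + 1) =>
        ∀ j : Fin 5, ((blockAge q R j c : Fin (2 * q + 1)) : ℕ) < 2 * q - R)).card := by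
  classical
  have hc := card_old_letters_le (q := q) (R := R)
  have hcompl : Finset.univ.filter (fun c : Fin (2 * q + 1) =>
        ∀ j : Fin 5, ((blockAge q R j c : Fin (2 * q + 1)) : ℕ) < 2 * q - R) =
      (Finset.univ.filter (fun c : Fin (2 * q + 1) =>
        ∃ j : Fin 5, 2 * q - R ≤ ((blockAge q R j c : Fin (2 * q + 1)) : ℕ)))ᶜ := by
    ext c
    simp only [Finset.mem_filter, Finset.mem_univ, true_and, Finset.mem_compl, not_exists, not_le]
  rw [hcompl, Finset.card_compl, Fintype.card_fin]
  omega

end Summit.ValiantsHypothesis.ValiantsHypothesis.Theorems.PeelingLemmaGadget
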